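import Summits.AtomisticToContinuum.Crystallization.Theorems.FrustratedLawDichotomyCertFloorTailsEnergy
import Summits.AtomisticToContinuum.Crystallization.Theorems.FrustratedLawDichotomyCertFloorTailsHost

/-!
# FrustratedLawDichotomy · crux `AperiodicFrustratedLawGap` (stmt-AtomisticToContinuum-27623) — THE TRUNCATED CERTIFICATE FLOOR (K-file entry point)
# (hdef side, class A: `certFloorNear − certFloorTails ≤ certFloor`, assembling the four truncation tails; decomp-a2c hand-1 g52, for CELL-SOUND (lens-5 g113 / census))

`certFloorNear a I y τ Rc L_d L_N R_N L_r` is `certFloor a I y τ Rc` ((226) `…CoherentFloor`) with its three whole-window columns replaced by NEAR sums — root-bond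
debits on `‖x‖ < L_d`, the NASH column on `‖z‖ ≤ R_N` with near adjoint coefficients `certCoeffNear … L_N`, the force-remainder column on pairs with `dist < L_r`
(the host term, the far force column and `tailCol` unchanged) — and `certFloorTails δ τ Y₁ L_d L_N R_N L_r` is the sum of the closed-form tails of
`…CertFloorTailsEnergy` / `…CertFloorTails` / `…CertFloorTailsRem` (`Y₁ = Σ_{x∈I}‖y_x‖`, `δ` = template separation, all tails in FarFieldSharp's `S_k(δ,·)`).

* ★★ `certFloorNear_sub_tails_le` — `certFloorNear … − certFloorTails δ τ (Σ_{x∈I}‖y_x‖) … ≤ certFloor a I y τ Rc` (template `δ`-separated, `I ⊆ a`, `0 ≤ τ`,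
  `τ < L_d`, `2τ < L_r`, `δ/2 ≤ L_d, L_N, R_N, L_r`, `‖x‖ + L_N ≤ R_N` on `I`);
* ★★★ `floor_of_near_of_nash` — THE K-FILE ENTRY POINT: a cell inequality `2·c ≤ certFloorNear … − certFloorTails …` plus the hypotheses of (226)
  `certFloor_le_two_mul_rootEnergy_of_nash` give `c ≤ rootEnergy V_LJ μ`;
* `certFloorNearB`, `certFloorNearB_sub_le` — the Bravais variant: the host column dropped and booked by `Σ_{x∈I}‖y_x‖·T0_δ(R_w − ‖x‖)`
  (`…CertFloorTailsHost.hostColumn_abs_le_of_window`, template mirror-closed inside radius `R_w`).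
Plain `def`s (no instance / notation); imports TREE `…CertFloorTailsEnergy` + `…CertFloorTailsHost`; 0 sorry.  All `[folklore]`.
-/

noncomputable section

namespace Summit.AtomisticToContinuum.Crystallization.Theorems.FrustratedLawDichotomyCertFloorNear

open MeasureTheory Metric Set RealInnerProductSpace
open scoped BigOperators
open Literature.MathematicalPhysics.StatisticalMechanics (lennardJones rootEnergy)
open Literature.Probability.Process (IsRootedHardCore)
open Summit.AtomisticToContinuum.Crystallization.Theorems.ChargedEnergyGapNegative (E3)
open Summit.AtomisticToContinuum.Crystallization.Theorems.FrustratedLawDichotomyCoherentSets (coherentAt)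
open Summit.AtomisticToContinuum.Crystallization.Theorems.FrustratedLawDichotomyCoherentFloorAlgebra
open Summit.AtomisticToContinuum.Crystallization.Theorems.FrustratedLawDichotomyCoherentFloor
open Summit.AtomisticToContinuum.Crystallization.Theorems.FrustratedLawDichotomyCertFloorTails (certCoeffNear nashColumn_le_near_add_tails)
open Summit.AtomisticToContinuum.Crystallization.Theorems.FrustratedLawDichotomyCertFloorTailsRem (remColumn_le_near_add_tail)
open Summit.AtomisticToContinuum.Crystallization.Theorems.FrustratedLawDichotomyCertFloorTailsEnergy (energyDebit_le_near_add_tail)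
open Summit.AtomisticToContinuum.Crystallization.Theorems.FrustratedLawDichotomyCertFloorTailsHost (hostColumn_abs_le_of_window)

/-- ★ THE TRUNCATED CERTIFICATE FLOOR: `certFloor` with NEAR sums in the debit (`‖x‖ < L_d`), NASH (`‖z‖ ≤ R_N`, coefficients cut at `L_N`) and
remainder (`dist < L_r`) columns — what a cell K-file evaluates. -/
def certFloorNear (a I : Finset E3) (y : E3 → E3) (τ Rc L_d L_N R_N L_r : ℝ) : ℝ :=
  ∑ x ∈ a.erase 0, phiT (‖x‖ ^ 2)
    - ∑ x ∈ (a.erase 0).filter (fun x => ‖x‖ < L_d), (τ ^ 2 * secondNeg ‖x‖ + energyRem ‖x‖ τ)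
    - τ * ∑ z ∈ (a.erase 0).filter (fun z => ‖z‖ ≤ R_N), ‖psiT (‖z‖ ^ 2) • z - certCoeffNear a I y L_N z‖
    - ∑ x ∈ I, ⟪y x, ∑ x' ∈ a.erase x, ljBondForce (x - x')⟫
    - ∑ x ∈ I, ‖y x‖ * farCol (Rc - (‖x‖ + τ))
    - 1 / 2 * ∑ x ∈ a, ∑ x' ∈ (a.erase x).filter (fun x' => dist x' x < L_r),
        ‖mulExt I y x - mulExt I y x'‖ * forceRem ‖x - x'‖ (dispB τ x + dispB τ x')
    - tailCol Rc

/-- ★ THE FOUR TAILS in closed form (`δ` template separation, `Y₁ = Σ_{x∈I}‖y_x‖`): root-bond debits beyond `L_d`, NASH sites beyond `R_N` and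
coefficient pairs beyond `L_N` (times `τ`), remainder pairs beyond `L_r`. -/
def certFloorTails (δ τ Y₁ L_d L_N R_N L_r : ℝ) : ℝ :=
  (τ ^ 2 * (7 / 2 * (3 / 5 * (2 / δ) ^ 3 * L_d⁻¹ ^ 5 + 7 * (2 / δ) ^ 2 * L_d⁻¹ ^ 6 + 3 / 7 * (2 / δ) * L_d⁻¹ ^ 7 + 2 * L_d⁻¹ ^ 8)
        + 1 / 2 * (3 / 11 * (2 / δ) ^ 3 * L_d⁻¹ ^ 11 + 13 / 2 * (2 / δ) ^ 2 * L_d⁻¹ ^ 12 + 3 / 13 * (2 / δ) * L_d⁻¹ ^ 13 + 2 * L_d⁻¹ ^ 14))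
      + τ ^ 3 * ((5 / 3 * (1 - τ / L_d)⁻¹ ^ 12 * (2 + τ / L_d) ^ 3 + 2 * (2 + τ / L_d))
          * (1 / 2 * (2 / δ) ^ 3 * L_d⁻¹ ^ 6 + 48 / 7 * (2 / δ) ^ 2 * L_d⁻¹ ^ 7 + 3 / 8 * (2 / δ) * L_d⁻¹ ^ 8 + 2 * L_d⁻¹ ^ 9)
        + (14 / 3 * (1 - τ / L_d)⁻¹ ^ 18 * (2 + τ / L_d) ^ 3 + 7 / 2 * (2 + τ / L_d))
          * (1 / 4 * (2 / δ) ^ 3 * L_d⁻¹ ^ 12 + 84 / 13 * (2 / δ) ^ 2 * L_d⁻¹ ^ 13 + 3 / 14 * (2 / δ) * L_d⁻¹ ^ 14 + 2 * L_d⁻¹ ^ 15)))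
  + τ * (((3 / 4 * (2 / δ) ^ 3 * R_N⁻¹ ^ 4 + 36 / 5 * (2 / δ) ^ 2 * R_N⁻¹ ^ 5 + 1 / 2 * (2 / δ) * R_N⁻¹ ^ 6 + 2 * R_N⁻¹ ^ 7)
          + (3 / 10 * (2 / δ) ^ 3 * R_N⁻¹ ^ 10 + 72 / 11 * (2 / δ) ^ 2 * R_N⁻¹ ^ 11 + 1 / 4 * (2 / δ) * R_N⁻¹ ^ 12 + 2 * R_N⁻¹ ^ 13))
      + 2 * Y₁ * (9 * (3 / 5 * (2 / δ) ^ 3 * L_N⁻¹ ^ 5 + 7 * (2 / δ) ^ 2 * L_N⁻¹ ^ 6 + 3 / 7 * (2 / δ) * L_N⁻¹ ^ 7 + 2 * L_N⁻¹ ^ 8)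
          + 15 * (3 / 11 * (2 / δ) ^ 3 * L_N⁻¹ ^ 11 + 13 / 2 * (2 / δ) ^ 2 * L_N⁻¹ ^ 12 + 3 / 13 * (2 / δ) * L_N⁻¹ ^ 13 + 2 * L_N⁻¹ ^ 14)))
  + Y₁ * ((2 * τ) ^ 2 *
      ((10 * (1 - 2 * τ / L_r)⁻¹ ^ 12 * (2 + 2 * τ / L_r) ^ 2 * (1 + 2 * τ / L_r) + 4 * (3 + 2 * τ / L_r))
          * (1 / 2 * (2 / δ) ^ 3 * L_r⁻¹ ^ 6 + 48 / 7 * (2 / δ) ^ 2 * L_r⁻¹ ^ 7 + 3 / 8 * (2 / δ) * L_r⁻¹ ^ 8 + 2 * L_r⁻¹ ^ 9)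
        + (28 * (1 - 2 * τ / L_r)⁻¹ ^ 18 * (2 + 2 * τ / L_r) ^ 2 * (1 + 2 * τ / L_r) + 7 * (3 + 2 * τ / L_r))
          * (1 / 4 * (2 / δ) ^ 3 * L_r⁻¹ ^ 12 + 84 / 13 * (2 / δ) ^ 2 * L_r⁻¹ ^ 13 + 3 / 14 * (2 / δ) * L_r⁻¹ ^ 14 + 2 * L_r⁻¹ ^ 15)))

/-- ★★ **TRUNCATION OF THE CERTIFICATE FLOOR**: `certFloorNear − certFloorTails ≤ certFloor`. [folklore] -/
theorem certFloorNear_sub_tails_le (a I : Finset E3) (y : E3 → E3) {δ τ Rc L_d L_N R_N L_r : ℝ} (hδ : 0 < δ)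
    (hsep : ∀ z ∈ a, ∀ z' ∈ a, z ≠ z' → δ ≤ dist z z') (hIa : I ⊆ a) (hτ0 : 0 ≤ τ)
    (hLd : δ / 2 ≤ L_d) (hτLd : τ < L_d) (hLN : δ / 2 ≤ L_N) (hRN : δ / 2 ≤ R_N) (hI : ∀ x ∈ I, ‖x‖ + L_N ≤ R_N)
    (hLr : δ / 2 ≤ L_r) (hτLr : 2 * τ < L_r) :
    certFloorNear a I y τ Rc L_d L_N R_N L_r - certFloorTails δ τ (∑ x ∈ I, ‖y x‖) L_d L_N R_N L_r ≤ certFloor a I y τ Rc := by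
  have h1 := energyDebit_le_near_add_tail a hδ hLd hτ0 hτLd hsep
  have h2 := mul_le_mul_of_nonneg_left (nashColumn_le_near_add_tails a I y hδ hLN hRN hsep hIa hI) hτ0
  have h3 := remColumn_le_near_add_tail a I y hδ hLr hτ0 hτLr hsep hIa
  unfold certFloor certFloorNear certFloorTails
  rw [Finset.sum_sub_distrib]
  linarith

/-- ★★★ **THE K-FILE ENTRY POINT.**  A cell inequality `2c ≤ certFloorNear − certFloorTails` (near sums + closed tails; `δ` the template separation,
dials `L_d, L_N, R_N, L_r`) together with the hypotheses of the class-A door (226) `certFloor_le_two_mul_rootEnergy_of_nash` gives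
`c ≤ rootEnergy V_LJ μ` for every rooted `7/10`-hard-core NASH configuration coherent with the template. [folklore] -/
theorem floor_of_near_of_nash {μ : Measure E3} {τ Rc : ℝ} {a I : Finset E3} (y : E3 → E3) {δ L_d L_N R_N L_r c : ℝ}
    (hcell : 2 * c ≤ certFloorNear a I y τ Rc L_d L_N R_N L_r - certFloorTails δ τ (∑ x ∈ I, ‖y x‖) L_d L_N R_N L_r)
    (hδ : 0 < δ) (hsep : ∀ z ∈ a, ∀ z' ∈ a, z ≠ z' → δ ≤ dist z z')
    (hLd : δ / 2 ≤ L_d) (hτLd : τ < L_d) (hLN : δ / 2 ≤ L_N) (hRN : δ / 2 ≤ R_N) (hIN : ∀ x ∈ I, ‖x‖ + L_N ≤ R_N)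
    (hLr : δ / 2 ≤ L_r) (hτLr : 2 * τ < L_r)
    (hμ : IsRootedHardCore (7 / 10) μ)
    (hNash : ∀ p : E3, μ {p} ≠ 0 → ∀ w : E3, (∀ q : E3, μ {q} ≠ 0 → q ≠ p → w ≠ q) →
      ∑' q : {q : E3 // μ {q} ≠ 0 ∧ q ≠ p}, lennardJones (dist p (q : E3)) ≤
        ∑' q : {q : E3 // μ {q} ≠ 0 ∧ q ≠ p}, lennardJones (dist w (q : E3)))
    (hτ0 : 0 ≤ τ) (hτ : 2 * τ < 7 / 10) (hRc : 1 ≤ Rc) (hcoh : μ ∈ coherentAt a τ Rc)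
    (h0a : (0 : E3) ∈ a) (hIa : I ⊆ a) (ha : ∀ x ∈ a, ∀ x' ∈ a, x ≠ x' → 2 * τ < dist x x')
    (hin : ∀ x ∈ a, ‖x‖ + τ ≤ Rc) (hI : ∀ x ∈ I, 7 / 20 ≤ Rc - (‖x‖ + τ)) :
    c ≤ rootEnergy lennardJones μ := by
  have h1 := certFloorNear_sub_tails_le a I y (Rc := Rc) hδ hsep hIa hτ0 hLd hτLd hLN hRN hIN hLr hτLr
  have h2 := certFloor_le_two_mul_rootEnergy_of_nash y hμ hNash hτ0 hτ hRc hcoh h0a hIa ha hin hI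
  linarith

/-- The BRAVAIS variant of the truncated floor: the host column dropped (it is booked as a tail via mirror symmetry). -/
def certFloorNearB (a I : Finset E3) (y : E3 → E3) (τ Rc L_d L_N R_N L_r : ℝ) : ℝ :=
  ∑ x ∈ a.erase 0, phiT (‖x‖ ^ 2)
    - ∑ x ∈ (a.erase 0).filter (fun x => ‖x‖ < L_d), (τ ^ 2 * secondNeg ‖x‖ + energyRem ‖x‖ τ)
    - τ * ∑ z ∈ (a.erase 0).filter (fun z => ‖z‖ ≤ R_N), ‖psiT (‖z‖ ^ 2) • z - certCoeffNear a I y L_N z‖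
    - ∑ x ∈ I, ‖y x‖ * farCol (Rc - (‖x‖ + τ))
    - 1 / 2 * ∑ x ∈ a, ∑ x' ∈ (a.erase x).filter (fun x' => dist x' x < L_r),
        ‖mulExt I y x - mulExt I y x'‖ * forceRem ‖x - x'‖ (dispB τ x + dispB τ x')
    - tailCol Rc

/-- ★ For a template MIRROR-CLOSED inside its window radius `R_w` (`x, x' ∈ a`, `‖2x − x'‖ ≤ R_w ⇒ 2x − x' ∈ a`) with `‖x‖ + δ/2 ≤ R_w` on `I`:
`certFloorNearB − Σ_{x∈I}‖y_x‖·T0_δ(R_w − ‖x‖) ≤ certFloorNear` (no host force is evaluated). [folklore] -/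
theorem certFloorNearB_sub_le (a I : Finset E3) (y : E3 → E3) {δ τ Rc L_d L_N R_N L_r R_w : ℝ} (hδ : 0 < δ)
    (hsep : ∀ z ∈ a, ∀ z' ∈ a, z ≠ z' → δ ≤ dist z z') (hIa : I ⊆ a)
    (hwin : ∀ x ∈ a, ∀ x' ∈ a, ‖(2 : ℝ) • x - x'‖ ≤ R_w → (2 : ℝ) • x - x' ∈ a) (hIw : ∀ x ∈ I, ‖x‖ + δ / 2 ≤ R_w) :
    certFloorNearB a I y τ Rc L_d L_N R_N L_r
        - ∑ x ∈ I, ‖y x‖ *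
          ((3 / 4 * (2 / δ) ^ 3 * (R_w - ‖x‖)⁻¹ ^ 4 + 36 / 5 * (2 / δ) ^ 2 * (R_w - ‖x‖)⁻¹ ^ 5 + 1 / 2 * (2 / δ) * (R_w - ‖x‖)⁻¹ ^ 6
              + 2 * (R_w - ‖x‖)⁻¹ ^ 7)
            + (3 / 10 * (2 / δ) ^ 3 * (R_w - ‖x‖)⁻¹ ^ 10 + 72 / 11 * (2 / δ) ^ 2 * (R_w - ‖x‖)⁻¹ ^ 11 + 1 / 4 * (2 / δ) * (R_w - ‖x‖)⁻¹ ^ 12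
              + 2 * (R_w - ‖x‖)⁻¹ ^ 13))
      ≤ certFloorNear a I y τ Rc L_d L_N R_N L_r := by
  have h := hostColumn_abs_le_of_window a I y hδ hsep hIa hwin hIw
  have h' := (abs_le.mp h).2
  unfold certFloorNear certFloorNearB
  linarith

end Summit.AtomisticToContinuum.Crystallization.Theorems.FrustratedLawDichotomyCertFloorNear

end
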